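import Summits.AtomisticToContinuum.Crystallization.Theorems.ThreeConeCertificateSlackRigidityPricedFloorsIncrIdent1
import Summits.AtomisticToContinuum.Crystallization.Theorems.ThreeConeCertificateSlackRigidityPricedFloorsLayerEnergy
import HarnessLib

/-!
# `SlackRigidity` (stmt-AtomisticToContinuum-11960), line `priced-floors-palm-exactification`, stub S3
# (`stub_layeredMeanSelection`), package (II): increment functionals, part 5 — evaluation at the
# re-rooted samples and the ideal fcc case

Lead c19, worker package (II), part 5: the facts that turn the deterministic identifications of
part 1 (`lms_ident_A/B/D`) into the a.e. identifications of `lms_increments_ae_zero'`.  For data `e`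
fitting the rooted separated sample `S` and the pattern point `y = pointOf e m i j`:

* `lms_rootEnergy_map_sub_pointOf` (registered) — `2h((count|S).map (· − y)) = LE e m`
  (`map_sub_count_restrict`, `Transport.dataSet_rerootData`, `LayerEnergy.two_mul_rootEnergy_reroot`);
* `lms_reroot_sample` (registered) — the re-rooted sample `S − y` is rooted, separated, fitted by
  `rerootData e m`, and `(count|S).map (· − y) = count|(S − y)`;
* `lms_D_map_sub_pointOf` (registered) — hence any functional `D` identified with `DE` on fitted
  rooted separated samples satisfies `D((count|S).map (· − y)) = jump e m + jump e (m − 2)`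
  (`DE_rerootData`);
* `lms_LE_zero_eq` (registered) — `LE e 0 = 2h(count|S)`;
* `lms_functionals_fcc` (registered) — on IDEAL FCC data (constant word, ideal spacing) every layer
  has the same energy and all jumps vanish: `AE n e = BE n e = LE e 0`, `VE n e = DtE n e = DE e = 0`
  (the degenerate case, where the transport kernel is the Dirac kernel at the root).

All `[folklore]` bookkeeping.
-/

noncomputable section

open MeasureTheory Filter Set
open scoped ENNReal BigOperators Topology

namespace Summit.AtomisticToContinuum.Crystallization.Theorems.SlackRigidityPricedFloorsIncrIdent

open Literature.Probability.Process
open Literature.MathematicalPhysics.StatisticalMechanics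
open Summit.AtomisticToContinuum.Crystallization.Theorems.SlackRigidityPricedFloors
open Summit.AtomisticToContinuum.Crystallization.Theorems.SlackRigidityPricedFloorsTransport
open Summit.AtomisticToContinuum.Crystallization.Theorems.SlackRigidityPricedFloorsLayerEnergy

/-! ## The re-rooted samples -/

/-- **Re-rooting the sample at a pattern point** (registered sub-goal `lms_reroot_sample`): `S − y`
for `y = pointOf e m i j` is rooted, `δ`-separated, fitted by `rerootData e m`, and its counting
measure is the push-forward of `count|S`. [folklore] -/
theorem lms_reroot_sample : ∀ (δ : ℝ) (S : Set E3) (e : LData), (0 : E3) ∈ S → (∀ x ∈ S, ∀ y ∈ S, x ≠ y → δ ≤ dist x y) → Fits S e → ∀ (m i j : ℤ), (0 : E3) ∈ ((fun z => z - pointOf e m i j) '' S) ∧ (∀ x ∈ ((fun z => z - pointOf e m i j) '' S), ∀ y ∈ ((fun z => z - pointOf e m i j) '' S), x ≠ y → δ ≤ dist x y) ∧ Fits ((fun z => z - pointOf e m i j) '' S) (rerootData e m) ∧ ((Measure.count : Measure E3).restrict S).map (fun z => z - pointOf e m i j) = (Measure.count : Measure E3).restrict ((fun z => z - pointOf e m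 i j) '' S) := by
  intro δ S e h0 hsep he m i j
  have hy : pointOf e m i j ∈ S := by
    rw [← he.2]
    exact ⟨m, i, j, rfl⟩
  refine ⟨⟨pointOf e m i j, hy, sub_self _⟩, ?_, lms_rerootData_fits S e m i j he, map_sub_count_restrict S _⟩
  rintro _ ⟨x, hx, rfl⟩ _ ⟨y, hy', rfl⟩ hne
  have hne' : x ≠ y := fun h => hne (by rw [h])
  simpa [dist_eq_norm] using hsep x hx y hy' hne'

/-- **Twice the root energy of the sample re-rooted at a point of layer `m` is `LE e m`** (registered
sub-goal `lms_rootEnergy_map_sub_pointOf`). [folklore] -/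
theorem lms_rootEnergy_map_sub_pointOf : ∀ (S : Set E3) (e : LData), Fits S e → ∀ (m i j : ℤ), 2 * rootEnergy lennardJones (((Measure.count : Measure E3).restrict S).map (fun z => z - pointOf e m i j)) = (inLayerInteraction lennardJones e.2.1 + ∑' m' : ℤ, if m' = m then (0 : ℝ) else layerInteraction lennardJones e.2.1 (e.2.2.2 m' - e.2.2.2 m) (haggLabel e.2.2.1 m' - haggLabel e.2.2.1 m) 1) := by
  rintro S e ⟨hne, rfl⟩ m i j
  rw [map_sub_count_restrict, ← dataSet_rerootData e m i j]
  exact two_mul_rootEnergy_reroot hne m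

/-- **A functional identified with `DE` evaluates to `jump e m + jump e (m−2)` at the sample
re-rooted at a point of layer `m`** (registered sub-goal `lms_D_map_sub_pointOf`). [folklore] -/
theorem lms_D_map_sub_pointOf : ∀ (δ : ℝ) (D : Measure E3 → ℝ), (∀ (S : Set E3) (e : LData), (0 : E3) ∈ S → (∀ x ∈ S, ∀ y ∈ S, x ≠ y → δ ≤ dist x y) → Fits S e → D ((Measure.count : Measure E3).restrict S) = ((e.2.2.2 1 - e.2.2.2 0) - (e.2.2.2 2 - e.2.2.2 1)) ^ 2 + ((e.2.2.2 (-1) - e.2.2.2 (-2)) - (e.2.2.2 0 - e.2.2.2 (-1))) ^ 2) → ∀ (S : Set E3) (e : LData), (0 : E3) ∈ S → (∀ x ∈ S, ∀ y ∈ S, x ≠ y → δ ≤ dist x y) → Fits S e → ∀ (m i j : ℤ), D (((Measure.count : Measure E3).restrict S).map (fun z => z - pointOf e m i j)) = ((e.2.2.2 (m + 1) - e.2.2.2 m) - (e.2.2.2 (m + 2) - e.2.2.2 (m + 1))) ^ 2 + ((e.2.2.2 (m - 1) - e.2.2.2 (m - 2)) - (e.2.2.2 m - e.2.2.2 (m -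 1))) ^ 2 := by
  intro δ D hD S e h0 hsep he m i j
  obtain ⟨h0', hsep', hfits', hmap⟩ := lms_reroot_sample δ S e h0 hsep he m i j
  rw [hmap, hD _ _ h0' hsep' hfits']
  exact DE_rerootData e m

/-- **The root layer energy is twice the root energy** (registered sub-goal `lms_LE_zero_eq`).
[folklore] -/
theorem lms_LE_zero_eq : ∀ (S : Set E3) (e : LData), Fits S e → (inLayerInteraction lennardJones e.2.1 + ∑' m' : ℤ, if m' = 0 then (0 : ℝ) else layerInteraction lennardJones e.2.1 (e.2.2.2 m' - e.2.2.2 0) (haggLabel e.2.2.1 m' - haggLabel e.2.2.1 0) 1) = 2 * rootEnergy lennardJones ((Measure.count : Measure E3).restrict S) := by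
  rintro S e ⟨hne, rfl⟩
  have h := two_mul_rootEnergy_reroot hne 0
  rw [rerootData_zero hne.2.2] at h
  exact h.symm

/-! ## The ideal fcc case -/

/-- Heights of normal fcc data are the arithmetic progression `z m = m · a√(2/3)`. [folklore] -/
theorem fcc_height {e : LData} (he : IsNormalData e) (hf : IsFccData e) (m : ℤ) :
    e.2.2.2 m = m * (e.2.1 * Real.sqrt (2 / 3)) := by
  induction m using Int.induction_on with
  | zero => simp [he.2.2]
  | succ n ih =>
    have h := hf.2 (n : ℤ)
    push_cast at ih ⊢
    linarith
  | pred n ih =>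
    have h := hf.2 (-(n : ℤ) - 1)
    rw [show -(n : ℤ) - 1 + 1 = -(n : ℤ) by ring] at h
    push_cast at ih ⊢
    linarith

/-- The word of fcc data is constant. [folklore] -/
theorem fcc_word {e : LData} (hf : IsFccData e) (m : ℤ) : e.2.2.1 m = e.2.2.1 0 := by
  induction m using Int.induction_on with
  | zero => rfl
  | succ n ih => rw [hf.1, ih]
  | pred n ih =>
    have h := hf.1 (-(n : ℤ) - 1)
    rw [show -(n : ℤ) - 1 + 1 = -(n : ℤ) by ring] at h
    rw [← h, ih]

/-- Labels of fcc data: `L m = m · s 0`. [folklore] -/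
theorem fcc_label {e : LData} (hf : IsFccData e) (m : ℤ) : haggLabel e.2.2.1 m = m * e.2.2.1 0 := by
  induction m using Int.induction_on with
  | zero => simp
  | succ n ih => rw [haggLabel_succ, ih, fcc_word hf (n : ℤ)]; ring
  | pred n ih =>
    have h := haggLabel_succ e.2.2.1 (-(n : ℤ) - 1)
    rw [show -(n : ℤ) - 1 + 1 = -(n : ℤ) by ring, ih, fcc_word hf (-(n : ℤ) - 1)] at h
    linarith

/-- Every layer of normal fcc data has the root layer's energy. [folklore] -/
theorem fcc_LE_eq {e : LData} (he : IsNormalData e) (hf : IsFccData e) (m : ℤ) : (inLayerInteraction lennardJones e.2.1 + ∑' m' : ℤ, if m' = m then (0 : ℝ) else layerInteraction lennardJones e.2.1 (e.2.2.2 m' - e.2.2.2 m) (haggLabel e.2.2.1 m' - haggLabel e.2.2.1 m) 1) = (inLayerInteraction lennardJones e.2.1 + ∑' m' : ℤ, if m' = 0 then (0 : ℝ) else layerInteraction lennardJones e.2.1 (e.2.2.2 m' - e.2.2.2 0) (haggLabel e.2.2.1 m' - haggLabel e.2.2.1 0) 1) := by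
  congr 1
  rw [← Equiv.tsum_eq (Equiv.addRight m)]
  refine tsum_congr fun k => ?_
  simp only [Equiv.coe_addRight]
  by_cases hk : k = 0
  · rw [if_pos (by rw [hk, zero_add]), if_pos hk]
  · rw [if_neg (fun h => hk (by simpa using h)), if_neg hk]
    congr 1
    · rw [fcc_height he hf, fcc_height he hf, fcc_height he hf, fcc_height he hf]
      push_cast
      ring
    · rw [fcc_label hf, fcc_label hf, fcc_label hf, fcc_label hf]
      ring

/-- **The functionals on ideal fcc data** (registered sub-goal `lms_functionals_fcc`): all layer
energies agree with the root layer energy and all increment jumps vanish. [folklore] -/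
theorem lms_functionals_fcc : ∀ (n : ℕ) (e : LData), IsNormalData e → IsFccData e → ((1 / (2 * (n : ℝ) + 1)) * ∑ m ∈ Finset.Icc (-(n : ℤ)) n, (inLayerInteraction lennardJones e.2.1 + ∑' m' : ℤ, if m' = m then (0 : ℝ) else layerInteraction lennardJones e.2.1 (e.2.2.2 m' - e.2.2.2 m) (haggLabel e.2.2.1 m' - haggLabel e.2.2.1 m) 1)) = (inLayerInteraction lennardJones e.2.1 + ∑' m' : ℤ, if m' = 0 then (0 : ℝ) else layerInteraction lennardJones e.2.1 (e.2.2.2 m' - e.2.2.2 0) (haggLabel e.2.2.1 m' - haggLabel e.2.2.1 0) 1) ∧ (∑ m ∈ Finset.Icc (-((n + 1 : ℕ) : ℤ)) ((n + 1 : ℕ) : ℤ), ((1 / (2 * (2 * (n : ℝ) + 1))) * ((if m ∈ Finset.Icc (-(n : ℤ) + 1) ((n : ℤ) + 1) then (1 : ℝ) else 0) + (if m ∈ Finset.Icc (-(n : ℤ) - 1) ((n : ℤ) - 1) then (1 : ℝ) else 0))) * (inLayerInteraction lennardJones e.2.1 + ∑' m' : ℤ, if m' = m then (0 : ℝ) else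 layerInteraction lennardJones e.2.1 (e.2.2.2 m' - e.2.2.2 m) (haggLabel e.2.2.1 m' - haggLabel e.2.2.1 m) 1)) = (inLayerInteraction lennardJones e.2.1 + ∑' m' : ℤ, if m' = 0 then (0 : ℝ) else layerInteraction lennardJones e.2.1 (e.2.2.2 m' - e.2.2.2 0) (haggLabel e.2.2.1 m' - haggLabel e.2.2.1 0) 1) ∧ ((1 / (2 * (n : ℝ) + 1)) * (∑ l ∈ Finset.range (2 * n), ((e.2.2.2 ((-(n : ℤ) + l) + 1) - e.2.2.2 (-(n : ℤ) + l)) - (e.2.2.2 ((-(n : ℤ) + l) + 2) - e.2.2.2 ((-(n : ℤ) + l) + 1))) ^ 2 + ∑ l ∈ Finset.range (2 * n), ((e.2.2.2 ((-(n : ℤ) - 1 + l) + 1) - e.2.2.2 (-(n : ℤ) - 1 + l)) - (e.2.2.2 ((-(n : ℤ) - 1 + l) + 2) - e.2.2.2 ((-(n : ℤ) - 1 + l) + 1))) ^ 2)) = 0 ∧ ((1 / (2 * (n : ℝ) + 1)) * ∑ m ∈ Finset.Icc (-(n : ℤ)) n, (((e.2.2.2 (m + 1) - e.2.2.2 m)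 - (e.2.2.2 (m + 2) - e.2.2.2 (m + 1))) ^ 2 + ((e.2.2.2 (m - 1) - e.2.2.2 (m - 2)) - (e.2.2.2 m - e.2.2.2 (m - 1))) ^ 2)) = 0 ∧ ((e.2.2.2 1 - e.2.2.2 0) - (e.2.2.2 2 - e.2.2.2 1)) ^ 2 + ((e.2.2.2 (-1) - e.2.2.2 (-2)) - (e.2.2.2 0 - e.2.2.2 (-1))) ^ 2 = 0 := by
  intro n e he hf
  have hz := fcc_height he hf
  have ht : (2 * (n : ℝ) + 1) ≠ 0 := by positivity
  refine ⟨?_, ?_, ?_, ?_, ?_⟩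
  · rw [Finset.sum_congr rfl fun m _ => fcc_LE_eq he hf m, Finset.sum_const, nsmul_eq_mul, card_Icc_neg_nat]
    field_simp
  · obtain ⟨-, -, -, hc1⟩ := shiftCoeff_props n
    rw [Finset.sum_congr rfl fun m _ => by rw [fcc_LE_eq he hf m], ← Finset.sum_mul, hc1, one_mul]
  · rw [Finset.sum_eq_zero fun l _ => ?_, Finset.sum_eq_zero fun l _ => ?_]
    · ring
    · simp only [hz]; push_cast; ring
    · simp only [hz]; push_cast; ring
  · rw [Finset.sum_eq_zero fun m _ => ?_]
    · ring
    · simp only [hz]; push_cast; ring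
  · simp only [hz]
    push_cast
    ring

end Summit.AtomisticToContinuum.Crystallization.Theorems.SlackRigidityPricedFloorsIncrIdent

end
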